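import Literature.AlgebraicGeometry.HodgeTheory.MotivatedClassesDeformationLeaves
import Literature.AlgebraicGeometry.HodgeTheory.MotivatedClassesPushforward
import Literature.AlgebraicGeometry.HodgeTheory.MotivatedClassesAlgebraic
import Literature.AlgebraicGeometry.HodgeTheory.MotivatedClassesAssembly
import HarnessLib

/-!
# André 1996 Prop. 2.1 (ii) — "motivated classes are stable under pull-back" reduced, by the graph
# formalism, to its first inclusion `pr_X^*(A_motᵖ(X)) ⊆ A_motᵖ(X ⊗ Z)`

The stub `stub_andreDeformation : Andre1996_deformation` (André 1996, Thm. 0.5) is reduced in the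
tree to three open leaves (`andreDeformation_of_three_leaves`,
`Theorems/HeckePrymWeilSummitOffWeilSectorAndreDeformationLeaves`), one of which is

> (A5) `Andre1996_motivatedClasses_pullback` (Y. André, *Pour une théorie inconditionnelle des
> motifs*, Publ. Math. IHÉS 83 (1996), Prop. 2.1 (ii) with p. 15): for a morphism `j : X ⟶ X̄` of
> smooth projective complex varieties, `j^*(A_motᵖ(X̄)_ℂ) ⊆ A_motᵖ(X)_ℂ`.

In print (p. 15: "On obtient le formalisme `f^*`, `f_*` (pour un morphisme `f`) en composant les
correspondances motivées avec la classe du graphe de `f` ou sa transposée") this is the composite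
of three facts: `j^* c = pr_{X*}(pr_{X̄}^* c ∪ [Γ_j])` (the graph formalism — PROVED in the tree on
the real carriers, `corrClassAction_graph`, `HodgeTheory/MotivatedClassesAlgebraic`, with `[Γ_j]`
algebraic, `complexGysin_graph_one_mem_algebraicClasses`); `pr_{X*}(A_mot(X × X̄)) ⊆ A_mot(X)`
(Prop. 2.1 (ii), SECOND inclusion — PROVED, `gysinMap_fst_mem_motivatedClasses`,
`HodgeTheory/MotivatedClassesPushforward`); and the two facts resting on André's Lemme 1.3.2 (the
Lefschetz involution of a product polarisation, through Künneth), which the real carriers do not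
have: Prop. 2.1 (ii), FIRST inclusion `pr_X^*(A_mot(X)) ⊆ A_mot(X × Z)`, and Prop. 2.1 (i)
(`A_mot(X)` is a subalgebra) in the weak form "motivated ∪ algebraic is motivated".

This file checks that reduction on the real carriers and removes the second of the two missing
facts in favour of an EXISTING named fact of the tree:

* `cupProduct_mem_motivatedClasses_of_cupProduct_algebraic` — **motivated ∪ algebraic is
  motivated**, GRANTED the named fact `Voisin2003_cupProduct_algebraicClasses` (Voisin II
  Prop. 9.20: the cup product of algebraic classes is algebraic; `HodgeTheory/MotivatedClassesAssembly`):
  for a generator `pr_{X*}(α ∪ *_L β)` and `γ` algebraic,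
  `pr_{X*}(α ∪ *_L β) ∪ γ = pr_{X*}((α ∪ pr_X^* γ) ∪ *_L β)` (projection formula
  `gysinMap_cupProduct_map`, associativity and graded commutativity of the cup product in even
  degrees, `cupProduct_assoc`, `cupProduct_gradedComm_holds`), with `α ∪ pr_X^* γ` algebraic (flat
  pull-back `map_fst_mem_supportedClasses` and the granted multiplicativity) — again a generator;
* `andreMotivatedPullback_of_prop21` — **(A5) from Prop. 2.1 (ii), first inclusion, and the weak
  Prop. 2.1 (i)**, both taken verbatim as hypotheses (the graph formalism above);
* `andreMotivatedPullback_of_cupProduct_of_mapFst` — **(A5) from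
  `Voisin2003_cupProduct_algebraicClasses` and Prop. 2.1 (ii), first inclusion** — so that, the
  multiplicativity of algebraic classes being already a hypothesis of the line
  (`stub_cupProductAlgebraic`), the only input of (A5) missing from the tree is André's
  `pr_X^{XZ *}(A_motᵖ(X)_ℂ) ⊆ A_motᵖ(X × Z)_ℂ` (Prop. 2.1 (ii), first inclusion; in print: Lemme 1.3.2).

No definition and no named fact is introduced; the hypotheses are the existing named fact
`Voisin2003_cupProduct_algebraicClasses` and the verbatim statement of Prop. 2.1 (ii), first
inclusion, on the real carriers.

## References

* [Andre1996Motifs] Y. André, Pour une théorie inconditionnelle des motifs, Publ. Math. IHÉS 83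
  (1996): §1.3 Lemme 1.3.2 (p. 13), §2.1 Déf. 1 and Prop. 2.1 (p. 14), proof and graph formalism
  (p. 15).
* [VoisinHodgeII2003] C. Voisin, Hodge Theory and Complex Algebraic Geometry II, CUP 2003, §9.2.4
  Prop. 9.20, proof of Thm. 10.17 (10.7).
* [FultonYoungTableaux1997] W. Fulton, Young Tableaux, CUP 1997, App. B §B.1 (2), (5), (6).
* [HatcherAT2002] A. Hatcher, Algebraic Topology, CUP 2002, §3.2 p. 211 and Thm. 3.11.

Provenance: Literature home (family `hodge`, layer `Literature/AlgebraicGeometry/HodgeTheory`, namespace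
`Literature.AlgebraicGeometry.HodgeTheory.MotivatedPullback`) of the Summits-side `Theorems/HeckePrymWeilSummitOffWeilSectorAndreMotivatedPullback` (cell `pub-hodge-ring2` ∕ route files
`HeckePrymWeilSummitOffWeilSector*`, the tree's derivation of André 1996 Prop. 2.1 (ii): motivated classes are stable
under pull-back), which `Literature/` may not import; theorems only, no named fact, no definition. Nothing here bears
on `HC_CM`; no case of the Hodge conjecture is proved. Lane `lit-hodgefound`, seat p20.
-/

noncomputable section

open _root_.CategoryTheory _root_.AlgebraicGeometry MonoidalCategory CartesianMonoidalCategory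
open Literature.AlgebraicTopology.SingularHomology Literature.Geometry.Kaehler
open Literature.AlgebraicGeometry Literature.AlgebraicGeometry.Motives
  Literature.AlgebraicGeometry.HodgeTheory

namespace Literature.AlgebraicGeometry.HodgeTheory.MotivatedPullback

/-- **Motivated ∪ algebraic is motivated, granted the multiplicativity of algebraic classes**
(André 1996, Prop. 2.1 (i): "`A_mot(X)_E` est une sous-`E`-algèbre de `H(X)`", in the weak form
with one factor algebraic, which is all the graph formalism of p. 15 consumes): for `X` smooth
projective of dimension `n`, `x ∈ A_motᵃ(X)_ℂ` and `γ ∈ Nᶜ H²ᶜ(X(ℂ); ℂ) = algebraicClasses X c`,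
`x ∪ γ ∈ A_motᵉ(X)_ℂ` (`2a + 2c = 2e`). On a generator `x = pr_{X*}(α ∪ *_L β)` (auxiliary `Y`,
orientations `μ`, `ν`, polarisation class `η` of `X ⊗ Y`):
`pr_{X*}(α ∪ *_L β) ∪ γ = pr_{X*}((α ∪ *_L β) ∪ pr_X^* γ) = pr_{X*}((α ∪ pr_X^* γ) ∪ *_L β)`
(projection formula, Fulton App. B (6), the tree's `gysinMap_cupProduct_map`; associativity and
graded commutativity in even degrees, Hatcher §3.2 and Thm. 3.11), and `α ∪ pr_X^* γ` is algebraic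
by flat pull-back (`map_fst_mem_supportedClasses`) and the GRANTED named fact
`Voisin2003_cupProduct_algebraicClasses` (Voisin II Prop. 9.20), so the right-hand side is again a
generator with the same `Y`, `μ`, `ν`, `η`, `β` (`isMotivatedClass_gysinMap`); for `e > n` the
target `H²ᵉ(X(ℂ); ℂ)` is `0`. [cite: Andre1996Motifs, Prop. 2.1 (i) (p. 14) and proof (p. 15)]
[cite: FultonYoungTableaux1997, Appendix B §B.1 (6)] [cite: VoisinHodgeII2003, §9.2.4 Prop. 9.20] -/
theorem cupProduct_mem_motivatedClasses_of_cupProduct_algebraic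
    (hV : Voisin2003_cupProduct_algebraicClasses) {n : ℕ} {X : SchemeOver ℂ}
    (hX : IsSmoothProjective n X) {a c e : ℕ} (h : 2 * a + 2 * c = 2 * e)
    {x : complexBetti X (2 * a)} (hx : x ∈ motivatedClasses n X a)
    {γ : complexBetti X (2 * c)} (hγ : γ ∈ algebraicClasses X c) :
    cupProduct h x γ ∈ motivatedClasses n X e := by
  classical
  by_cases he : e ≤ n
  swap
  · haveI := subsingleton_complexBetti hX (show 2 * n < 2 * e by omega)
    rw [Subsingleton.elim (cupProduct h x γ) 0]
    exact Submodule.zero_mem _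
  suffices hle : motivatedClasses n X a ≤
      (motivatedClasses n X e).comap ((cupProduct h).flip γ) from hle hx
  rw [motivatedClasses_le_iff]
  rintro y ⟨m, Y, hY, μ, ν, hμ, hν, η, hη, a₀, b, b', q, hbb', hab, hq, α, β, hα, hβ, rfl⟩
  rw [Submodule.mem_comap, LinearMap.flip_apply]
  have hXY : IsSmoothProjective (n + m) (X ⊗ Y) := IsSmoothProjective.tensor_holds hX hY
  -- `pr_X^* γ` is algebraic on `X ⊗ Y` (flat pull-back)
  have hγ' : complexBetti.map (fst X Y) (2 * c) γ ∈ algebraicClasses (X ⊗ Y) c :=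
    map_fst_mem_supportedClasses hX hY hγ
  -- projection formula: `pr_{X*}(w) ∪ γ = pr_{X*}(w ∪ pr_X^* γ)`
  rw [← gysinMap_cupProduct_map hν (AlgPoints.mapContinuous (L := ℂ) (fst X Y))
    (show 2 * (a + m) + 2 * c = 2 * (e + m) by omega)
    (show 2 * (e + m) + 2 * (q - c) = 2 * (n + m) by omega)
    (show 2 * e + 2 * (q - c) = 2 * n by omega)
    (show 2 * c + 2 * (q - c) = 2 * q by omega) _ _ h]
  -- `(α ∪ *_L β) ∪ pr_X^* γ = (α ∪ pr_X^* γ) ∪ *_L β` (associativity; graded commutativity, even degrees)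
  have hstep : cupProduct (show 2 * (a + m) + 2 * c = 2 * (e + m) by omega)
      (cupProduct (show 2 * a₀ + 2 * b' = 2 * (a + m) by omega) α
        (lefschetzInvolution hη.hasHardLefschetz (show 2 * b + 2 * b' = 2 * (n + m) by omega) β))
      (complexBetti.map (fst X Y) (2 * c) γ) =
    cupProduct (show 2 * (a₀ + c) + 2 * b' = 2 * (e + m) by omega)
      (cupProduct (two_mul_add_two_mul a₀ c) α (complexBetti.map (fst X Y) (2 * c) γ))
      (lefschetzInvolution hη.hasHardLefschetz (show 2 * b + 2 * b' = 2 * (n + m) by omega) β) := by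
    rw [cupProduct_assoc (show 2 * a₀ + 2 * b' = 2 * (a + m) by omega)
        (show 2 * b' + 2 * c = 2 * (b' + c) by omega)
        (show 2 * (a + m) + 2 * c = 2 * (e + m) by omega)
        (show 2 * a₀ + 2 * (b' + c) = 2 * (e + m) by omega),
      cupProduct_gradedComm_holds ℂ (ComplexPoints (X ⊗ Y))
        (show 2 * b' + 2 * c = 2 * (b' + c) by omega) (show 2 * c + 2 * b' = 2 * (b' + c) by omega),
      Even.neg_one_pow ((even_two_mul b').mul_right (2 * c)), one_smul,
      ← cupProduct_assoc (two_mul_add_two_mul a₀ c)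
        (show 2 * c + 2 * b' = 2 * (b' + c) by omega)
        (show 2 * (a₀ + c) + 2 * b' = 2 * (e + m) by omega)
        (show 2 * a₀ + 2 * (b' + c) = 2 * (e + m) by omega)]
  rw [hstep]
  exact (isMotivatedClass_gysinMap (n := n) (X := X) (p := e) hY μ ν hμ hν hη (a := a₀ + c) (b := b)
    (b' := b') (q := q - c) hbb' (by omega) (by omega) (hV hXY hα hγ') hβ).mem_motivatedClasses

/-- **(A5) from André's Prop. 2.1 (ii), first inclusion, and the weak Prop. 2.1 (i)** (André 1996,
p. 15: "On obtient le formalisme `f^*`, `f_*` (pour un morphisme `f`) en composant les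
correspondances motivées avec la classe du graphe de `f`"), on the real carriers: GRANTED
`hpull` — Prop. 2.1 (ii), first inclusion "`pr^{XZ *}_X A_mot(X)_E ⊆ A_mot(X × Z)_E`", verbatim for
`A_motᵖ(–)_ℂ = motivatedClasses` — and `hcup` — motivated ∪ algebraic is motivated (Prop. 2.1 (i),
weak form) — the named fact `Andre1996_motivatedClasses_pullback` holds: for `j : X ⟶ X̄`
(dimensions `n`, `m`) and `c ∈ A_motᵖ(X̄)_ℂ`, `j^* c = [Γ_j]^* c = pr_{X*}(pr_{X̄}^* c ∪ (𝟙, j)_* 1)`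
(the tree's graph formalism `corrClassAction_graph`, any orientation family, Poincaré duality
unconditional); `pr_{X̄}^* c ∈ A_motᵖ(X ⊗ X̄)` by `hpull` for the first factor of `X̄ ⊗ X` and the
swap `X ⊗ X̄ ≅ X̄ ⊗ X` (`map_mem_motivatedClasses_of_iso`); `∪ (𝟙, j)_* 1` stays motivated by `hcup`,
the graph class being algebraic (`complexGysin_graph_one_mem_algebraicClasses`); and `pr_{X*}`
preserves motivated classes (Prop. 2.1 (ii), second inclusion, the tree's
`gysinMap_fst_mem_motivatedClasses`). For `p > n`, `H²ᵖ(X(ℂ); ℂ) = 0`.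
[cite: Andre1996Motifs, Prop. 2.1 (p. 14) and the graph formalism (p. 15)]
[cite: VoisinHodgeII2003, proof of Thm. 10.17 (10.7)] [cite: FultonYoungTableaux1997, Appendix B §B.1 (2), (5), (6)] -/
theorem andreMotivatedPullback_of_prop21
    (hpull : ∀ ⦃n l : ℕ⦄ ⦃X Z : SchemeOver ℂ⦄, IsSmoothProjective n X → IsSmoothProjective l Z →
      ∀ (p : ℕ), ∀ x ∈ motivatedClasses n X p,
        complexBetti.map (fst X Z) (2 * p) x ∈ motivatedClasses (n + l) (X ⊗ Z) p)
    (hcup : ∀ ⦃n : ℕ⦄ ⦃X : SchemeOver ℂ⦄, IsSmoothProjective n X →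
      ∀ ⦃a c e : ℕ⦄ (h : 2 * a + 2 * c = 2 * e), ∀ x ∈ motivatedClasses n X a,
        ∀ γ ∈ algebraicClasses X c, cupProduct h x γ ∈ motivatedClasses n X e) :
    Andre1996_motivatedClasses_pullback := by
  intro m n Xbar X j hXbar hX p c hc
  classical
  by_cases hp : p ≤ n
  swap
  · haveI := subsingleton_complexBetti hX (show 2 * n < 2 * p by omega)
    rw [Subsingleton.elim (complexBetti.map j (2 * p) c) 0]
    exact Submodule.zero_mem _
  obtain ⟨μ, hμ⟩ : ∃ μ : OrientationFamily, μ.HasPoincareDuality :=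
    ⟨fun _ _ h ↦ Classical.choice (ComplexPoints.isOrientableOver ℂ h),
      OrientationFamily.hasPoincareDuality _⟩
  have hW : IsSmoothProjective (n + m) (X ⊗ Xbar) := IsSmoothProjective.tensor_holds hX hXbar
  have hq : 2 * p + 2 * (n - p) = 2 * n := by omega
  -- `j^* c = [Γ_j]^* c = pr_{X*}(pr_{X̄}^* c ∪ [Γ_j])`
  have e := corrClassAction_graph μ hμ hX hW j hq c
  rw [corrClassAction_apply] at e
  rw [← e]
  set Γ := complexGysin μ hX hW (lift (𝟙 X) j) (show 0 + 2 * (n + m) = 2 * m + 2 * n by omega)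
    (singularCohomology.one ℂ (ComplexPoints X))
  -- `pr_{X̄}^* c` is motivated: `hpull` for the first factor of `X̄ ⊗ X`, and the swap
  have hsnd : complexBetti.map (snd X Xbar) (2 * p) c ∈ motivatedClasses (n + m) (X ⊗ Xbar) p := by
    obtain ⟨σ, hσ⟩ : ∃ σ : X ⊗ Xbar ≅ Xbar ⊗ X, σ.hom ≫ fst Xbar X = snd X Xbar :=
      ⟨⟨lift (snd X Xbar) (fst X Xbar), lift (snd Xbar X) (fst Xbar X),
        CartesianMonoidalCategory.hom_ext _ _ (by simp) (by simp),
        CartesianMonoidalCategory.hom_ext _ _ (by simp) (by simp)⟩, lift_fst _ _⟩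
    have hZX : IsSmoothProjective (n + m) (Xbar ⊗ X) := by
      rw [Nat.add_comm]
      exact IsSmoothProjective.tensor_holds hXbar hX
    have h1 : complexBetti.map (fst Xbar X) (2 * p) c ∈ motivatedClasses (n + m) (Xbar ⊗ X) p := by
      have := hpull hXbar hX p c hc
      rwa [Nat.add_comm m n] at this
    rw [← hσ, complexBetti.map_comp, CategoryTheory.comp_apply]
    exact map_mem_motivatedClasses_of_iso hZX hW σ h1
  -- the graph class is algebraic
  have hΓ : Γ ∈ algebraicClasses (X ⊗ Xbar) m :=
    complexGysin_graph_one_mem_algebraicClasses μ hμ hX hW j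
  -- motivated ∪ algebraic is motivated, in degree `2 (p + m)`
  have hcupm := hcup hW (show 2 * p + 2 * m = 2 * (p + m) by omega) _ hsnd _ hΓ
  -- degree bookkeeping `2 p + 2 m = 2 (p + m)`
  have key : ∀ {D : ℕ} (hD : 2 * p + 2 * m = D) (e1 : D + 2 * (n - p) = 2 * (n + m)),
      gysinMap (μ hW) (μ hX) (AlgPoints.mapContinuous (L := ℂ) (fst X Xbar)) e1 hq
          (cupProduct hD (complexBetti.map (snd X Xbar) (2 * p) c) Γ) =
        gysinMap (μ hW) (μ hX) (AlgPoints.mapContinuous (L := ℂ) (fst X Xbar))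
          (show 2 * p + 2 * m + 2 * (n - p) = 2 * (n + m) by omega) hq
          (cupProduct rfl (complexBetti.map (snd X Xbar) (2 * p) c) Γ) := by
    rintro D rfl e1
    rfl
  rw [← key (show 2 * p + 2 * m = 2 * (p + m) by omega)
    (show 2 * (p + m) + 2 * (n - p) = 2 * (n + m) by omega)]
  exact gysinMap_fst_mem_motivatedClasses hX hXbar (μ hW) (μ hX) (hμ hW) (hμ hX) _ hq hcupm

/-- **(A5) from the multiplicativity of algebraic classes and André's Prop. 2.1 (ii), first
inclusion.** GRANTED the tree's named fact `Voisin2003_cupProduct_algebraicClasses` (Voisin II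
Prop. 9.20; already a hypothesis of the line, `stub_cupProductAlgebraic`) and André's
"`pr^{XZ *}_X A_mot(X)_E ⊆ A_mot(X × Z)_E`" (Prop. 2.1 (ii), first inclusion, on the real carriers;
in print a consequence of Lemme 1.3.2, the Lefschetz involution of a product polarisation through
Künneth — the one input of (A5) the tree lacks), the named fact
`Andre1996_motivatedClasses_pullback` holds (`andreMotivatedPullback_of_prop21` with
`cupProduct_mem_motivatedClasses_of_cupProduct_algebraic`).
[cite: Andre1996Motifs, Prop. 2.1 (p. 14), Lemme 1.3.2 (p. 13) and p. 15]
[cite: VoisinHodgeII2003, §9.2.4 Prop. 9.20] -/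
theorem andreMotivatedPullback_of_cupProduct_of_mapFst :
    Voisin2003_cupProduct_algebraicClasses →
      (∀ ⦃n l : ℕ⦄ ⦃X Z : SchemeOver ℂ⦄, IsSmoothProjective n X → IsSmoothProjective l Z →
        ∀ (p : ℕ), ∀ x ∈ motivatedClasses n X p,
          complexBetti.map (fst X Z) (2 * p) x ∈ motivatedClasses (n + l) (X ⊗ Z) p) →
      Andre1996_motivatedClasses_pullback :=
  fun hV hpull => andreMotivatedPullback_of_prop21 hpull
    fun _ _ hX _ _ _ h _ hx _ hγ => cupProduct_mem_motivatedClasses_of_cupProduct_algebraic hV hX h hx hγ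

end Literature.AlgebraicGeometry.HodgeTheory.MotivatedPullback

end
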